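import Summits.BirchSwinnertonDyer.BirchSwinnertonDyer.Theorems.PrintCf2SplitBadTwoCMPrimaryDyadicValue
import HarnessLib

/-!
# Crux `PrintCf2.SplitBadTwoRankOneOfFacts` (stmt-BirchSwinnertonDyer-20368), road α v10.3 — brick B15 file 10: the signs of `Γ_K` on `√2` and `√−2`
# from the cyclotomic character mod `8` (`√2 = ζ₈ + ζ₈⁻¹`, `√−2 = ζ₈ + ζ₈³`) — the input of the EVEN-`d` rows of the dyadic table

Cell `bsd-print-cf2`, width seat `bsd-line-cf2-p1-w2` g9 (prover-bsd-line-cf2-p1-w2-g9-0); brick B15 (memo `Cruxes/SplitBadTwoRankOneOfFacts/B15-DYADIC-EXACT-w2g9.md`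
§3, keys (0,·)); `--supports stmt-BirchSwinnertonDyer-20368` (helper, Theses-free). HONEST FRAMING: nothing here closes the crux or a registered stub; BSD is
not proved by any of this; no summit statement is proved by this seat. No definition, no named fact, no `sorry`.

WHAT (any number field `K`, `ι = absClosureEmbedding ℚ K`, `ε = χ₂` the `2`-adic cyclotomic character, `t := ε(g) mod 8 ∈ {1,3,5,7}`):
* `exists_primitive_eighth_root` — a `w ∈ K̄` with `w² = ι√(−1)`, so `w⁴ = −1`, `w⁸ = 1`, `(w − w³)² = 2`, `(w + w³)² = −2`;
* **`smul_geomSqrt_two_eq_of_cyclotomicCharacter`** — `g • ι√2 = ι√2` if `t ∈ {1, 7}`, `= −ι√2` if `t ∈ {3, 5}` (`g w = w^t`, `GaloisRep.cyclotomicCharacter_spec`);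
* **`smul_geomSqrt_neg_two_eq_of_cyclotomicCharacter`** — `g • ι√(−2) = ι√(−2)` if `t ∈ {1, 3}`, `= −ι√(−2)` if `t ∈ {5, 7}`.
So for EVEN `d = 2d'` the sign of any `g ∈ Γ_{K_{v̄}}` on `ι√d` is determined by `ε(g) mod 8` and its sign on `√(±d')` (files 5, 4), which makes the
(Hv̄-triv)/(Hv̄-move) decision from (C3-loc) computable on the keys (0,1), (0,3), (0,5), (0,7) (file 11). presearch: Serre *Cours d'arithmétique* II §3,
Neukirch II (7.13), Washington §9 (`ℚ(ζ₈) ∋ √2, √−2`) — held; no fact filed. beyond-print theorem: no.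

References: [SerreAbelianLadic1968] Ch. I §1.2; [Serre1973] Ch. II §3.3; [Washington1997] §9.
-/

noncomputable section

open scoped Classical

set_option linter.dupNamespace false
set_option autoImplicit false

namespace Summit.BirchSwinnertonDyer.BirchSwinnertonDyer.Theorems.PrintCf2.CMPrimes

open WeierstrassCurve Literature.NumberTheory.EllipticCurves Literature.NumberTheory.GaloisRepresentations Field NumberField

variable (K : Type) [Field K] [NumberField K]

/-- Units of `ℤ/8` have odd representatives: `t ∈ {1, 3, 5, 7}`. [folklore] -/
theorem zmod_eight_unit_cases (t : ZMod (2 ^ 3)) (ht : IsUnit t) : t = 1 ∨ t = 3 ∨ t = 5 ∨ t = 7 := by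
  revert ht; revert t; decide

/-- **A primitive eighth root of unity `w ∈ K̄` adapted to `ζ₄ = ι√(−1)`**: `w² = ι√(−1)`, hence `w⁴ = −1`, `w⁸ = 1`, `(w − w³)² = 2 = (ι√2)²` and
`(w + w³)² = −2 = (ι√(−2))²`. [cite: Washington1997, §9] -/
theorem exists_primitive_eighth_root :
    ∃ w : AlgebraicClosure K, w ^ 2 = absClosureEmbedding ℚ K (WeierstrassCurve.geomSqrt (-1 : ℚ)) ∧ w ^ 4 = -1 ∧ w ^ 2 ^ 3 = 1 ∧
      (w - w ^ 3) ^ 2 = absClosureEmbedding ℚ K (WeierstrassCurve.geomSqrt (2 : ℚ)) ^ 2 ∧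
      (w + w ^ 3) ^ 2 = absClosureEmbedding ℚ K (WeierstrassCurve.geomSqrt (-2 : ℚ)) ^ 2 := by
  set Z := absClosureEmbedding ℚ K (WeierstrassCurve.geomSqrt (-1 : ℚ)) with hZ
  have hZ2 : Z ^ 2 = -1 := absClosureEmbedding_geomSqrt_neg_one_sq K
  obtain ⟨w, hw⟩ := IsAlgClosed.exists_pow_nat_eq Z two_pos
  have hw4 : w ^ 4 = -1 := by rw [show (4 : ℕ) = 2 * 2 from rfl, pow_mul, hw, hZ2]
  have h2 : absClosureEmbedding ℚ K (WeierstrassCurve.geomSqrt (2 : ℚ)) ^ 2 = 2 := by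
    rw [← map_pow, WeierstrassCurve.geomSqrt_sq, AlgHom.commutes, map_ofNat]
  have hm2 : absClosureEmbedding ℚ K (WeierstrassCurve.geomSqrt (-2 : ℚ)) ^ 2 = -2 := by
    rw [← map_pow, WeierstrassCurve.geomSqrt_sq, AlgHom.commutes, map_neg, map_ofNat]
  refine ⟨w, hw, hw4, by rw [show (2 : ℕ) ^ 3 = 4 * 2 from rfl, pow_mul, hw4, neg_one_sq], ?_, ?_⟩
  · rw [h2]; linear_combination (w ^ 2 - 2) * hw4
  · rw [hm2]; linear_combination (w ^ 2 + 2) * hw4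

/-- **The sign of `g ∈ Γ_K` on `ι√2` is `+1` iff `ε(g) ≡ ±1 (mod 8)`** (`√2 = ±(ζ₈ − ζ₈³)`, `gζ₈ = ζ₈^{ε(g)}`). [cite: SerreAbelianLadic1968, Ch. I §1.2] -/
theorem smul_geomSqrt_two_eq_of_cyclotomicCharacter (g : absoluteGaloisGroup K) :
    ((PadicInt.toZModPow 3 ((GaloisRep.cyclotomicCharacter K 2 g : ℤ_[2]ˣ) : ℤ_[2]) = 1 ∨
        PadicInt.toZModPow 3 ((GaloisRep.cyclotomicCharacter K 2 g : ℤ_[2]ˣ) : ℤ_[2]) = 7) →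
      g • absClosureEmbedding ℚ K (WeierstrassCurve.geomSqrt (2 : ℚ)) = absClosureEmbedding ℚ K (WeierstrassCurve.geomSqrt (2 : ℚ))) ∧
    ((PadicInt.toZModPow 3 ((GaloisRep.cyclotomicCharacter K 2 g : ℤ_[2]ˣ) : ℤ_[2]) = 3 ∨
        PadicInt.toZModPow 3 ((GaloisRep.cyclotomicCharacter K 2 g : ℤ_[2]ˣ) : ℤ_[2]) = 5) →
      g • absClosureEmbedding ℚ K (WeierstrassCurve.geomSqrt (2 : ℚ)) = -absClosureEmbedding ℚ K (WeierstrassCurve.geomSqrt (2 : ℚ))) := by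
  haveI : Fact (Nat.Prime 2) := ⟨Nat.prime_two⟩
  obtain ⟨w, -, hw4, hw8, hsq, -⟩ := exists_primitive_eighth_root K
  set A := absClosureEmbedding ℚ K (WeierstrassCurve.geomSqrt (2 : ℚ)) with hA
  have hspec := GaloisRep.cyclotomicCharacter_spec K 2 (k := 3) g w hw8
  set c := (GaloisRep.cyclotomicCharacter K 2 g).val.toZModPow 3 with hc
  -- `g (w − w³) = w^c − w^{3c}`
  have hgt : g • (w - w ^ 3) = w ^ c.val - (w ^ c.val) ^ 3 := by rw [smul_sub, smul_pow', hspec]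
  -- `w − w³ = ±A`
  have hpm : w - w ^ 3 = A ∨ w - w ^ 3 = -A := sq_eq_sq_iff_eq_or_eq_neg.mp hsq
  constructor
  · intro h
    have hval : c.val = 1 ∨ c.val = 7 := by
      rcases h with h | h
      · left; rw [show c = 1 from h]; rfl
      · right; rw [show c = 7 from h]; rfl
    have hfix : g • (w - w ^ 3) = w - w ^ 3 := by
      rw [hgt]
      rcases hval with hv | hv <;> rw [hv]
      · ring
      · linear_combination (w ^ 3 - w ^ 17 + w ^ 13 - w ^ 9 + w ^ 5 - w) * hw4
    rcases hpm with hp | hp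
    · rw [← hp, hfix]
    · have : g • A = g • (-(w - w ^ 3)) := by rw [hp, neg_neg]
      rw [this, smul_neg, hfix, hp, neg_neg]
  · intro h
    have hval : c.val = 3 ∨ c.val = 5 := by
      rcases h with h | h
      · left; rw [show c = 3 from h]; rfl
      · right; rw [show c = 5 from h]; rfl
    have hneg : g • (w - w ^ 3) = -(w - w ^ 3) := by
      rw [hgt]
      rcases hval with hv | hv <;> rw [hv]
      · linear_combination (-(w ^ 5) + w) * hw4
      · linear_combination (w - w ^ 11 + w ^ 7 - w ^ 3) * hw4
    rcases hpm with hp | hp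
    · rw [← hp, hneg]
    · have : g • A = g • (-(w - w ^ 3)) := by rw [hp, neg_neg]
      rw [this, smul_neg, hneg, hp, neg_neg]

/-- **The sign of `g ∈ Γ_K` on `ι√(−2)` is `+1` iff `ε(g) ≡ 1, 3 (mod 8)`** (`√(−2) = ±(ζ₈ + ζ₈³)`). [cite: SerreAbelianLadic1968, Ch. I §1.2] -/
theorem smul_geomSqrt_neg_two_eq_of_cyclotomicCharacter (g : absoluteGaloisGroup K) :
    ((PadicInt.toZModPow 3 ((GaloisRep.cyclotomicCharacter K 2 g : ℤ_[2]ˣ) : ℤ_[2]) = 1 ∨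
        PadicInt.toZModPow 3 ((GaloisRep.cyclotomicCharacter K 2 g : ℤ_[2]ˣ) : ℤ_[2]) = 3) →
      g • absClosureEmbedding ℚ K (WeierstrassCurve.geomSqrt (-2 : ℚ)) = absClosureEmbedding ℚ K (WeierstrassCurve.geomSqrt (-2 : ℚ))) ∧
    ((PadicInt.toZModPow 3 ((GaloisRep.cyclotomicCharacter K 2 g : ℤ_[2]ˣ) : ℤ_[2]) = 5 ∨
        PadicInt.toZModPow 3 ((GaloisRep.cyclotomicCharacter K 2 g : ℤ_[2]ˣ) : ℤ_[2]) = 7) →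
      g • absClosureEmbedding ℚ K (WeierstrassCurve.geomSqrt (-2 : ℚ)) = -absClosureEmbedding ℚ K (WeierstrassCurve.geomSqrt (-2 : ℚ))) := by
  haveI : Fact (Nat.Prime 2) := ⟨Nat.prime_two⟩
  obtain ⟨w, -, hw4, hw8, -, hsq⟩ := exists_primitive_eighth_root K
  set A := absClosureEmbedding ℚ K (WeierstrassCurve.geomSqrt (-2 : ℚ)) with hA
  have hspec := GaloisRep.cyclotomicCharacter_spec K 2 (k := 3) g w hw8
  set c := (GaloisRep.cyclotomicCharacter K 2 g).val.toZModPow 3 with hc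
  have hgt : g • (w + w ^ 3) = w ^ c.val + (w ^ c.val) ^ 3 := by rw [smul_add, smul_pow', hspec]
  have hpm : w + w ^ 3 = A ∨ w + w ^ 3 = -A := sq_eq_sq_iff_eq_or_eq_neg.mp hsq
  constructor
  · intro h
    have hval : c.val = 1 ∨ c.val = 3 := by
      rcases h with h | h
      · left; rw [show c = 1 from h]; rfl
      · right; rw [show c = 3 from h]; rfl
    have hfix : g • (w + w ^ 3) = w + w ^ 3 := by
      rw [hgt]
      rcases hval with hv | hv <;> rw [hv]
      · ring
      · linear_combination (w ^ 5 - w) * hw4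
    rcases hpm with hp | hp
    · rw [← hp, hfix]
    · have : g • A = g • (-(w + w ^ 3)) := by rw [hp, neg_neg]
      rw [this, smul_neg, hfix, hp, neg_neg]
  · intro h
    have hval : c.val = 5 ∨ c.val = 7 := by
      rcases h with h | h
      · left; rw [show c = 5 from h]; rfl
      · right; rw [show c = 7 from h]; rfl
    have hneg : g • (w + w ^ 3) = -(w + w ^ 3) := by
      rw [hgt]
      rcases hval with hv | hv <;> rw [hv]
      · linear_combination (w + w ^ 11 - w ^ 7 + w ^ 3) * hw4
      · linear_combination (w ^ 3 + w ^ 17 - w ^ 13 + w ^ 9 - w ^ 5 + w) * hw4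
    rcases hpm with hp | hp
    · rw [← hp, hneg]
    · have : g • A = g • (-(w + w ^ 3)) := by rw [hp, neg_neg]
      rw [this, smul_neg, hneg, hp, neg_neg]

end Summit.BirchSwinnertonDyer.BirchSwinnertonDyer.Theorems.PrintCf2.CMPrimes

end
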